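import Summits.HubbardSuperconductivity.HubbardSuperconductivity.Theorems.FunctionFieldCertificateWindowInfraredBoundMesoscopicCeilingMajorant
import Summits.HubbardSuperconductivity.HubbardSuperconductivity.Theorems.FunctionFieldCertificateWindowInfraredBoundMesoscopicCeiling
import Summits.HubbardSuperconductivity.HubbardSuperconductivity.Theorems.FunctionFieldCertificateWindowInfraredBoundStubShellCover
import Summits.HubbardSuperconductivity.HubbardSuperconductivity.Theorems.WindowInfraredBound.Negative.ParsevalCeiling
import Mathlib.Analysis.SpecialFunctions.Trigonometric.Bounds
import HarnessLib

/-!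
# Crux `WindowInfraredBound` (stmt-HubbardSuperconductivity-1089) — MESOSCOPIC-CEILING glue, file 3: crux ⇒ (MC), hence `↔`

Support file (`--supports stmt-HubbardSuperconductivity-1089`; no definition, no named fact, sorry-free). Files 1–2
(`…MesoscopicCeilingMajorant.lean`, `…MesoscopicCeiling.lean`) proved the Fejér MAJORANT of the window and (MC) ⇒ crux; this
file proves the converse, so the mesoscopic ceiling (MC) of idea `mesoscopic-ceiling-block-coherence` is a kernel-checked
EQUIVALENT restatement of the crux (round-2 triage: "(MC) ↔ crux", "crux-equivalent"). Notation as in file 1 (`T_R(ψ)` = Fejér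
box of `MesoscopicPairOrder`, `S_ψ(m) = pairStructureFactor g L ψ m`, block kernel `F_R(m) = Σ_{u ∈ [0,R)²} χ_m(u)`).
* `blockDefect_le_of_windowBounds` (one side, one vector, any `g`): window bounds `Σ_{m≠0,|q_m|≤ε} S_ψ(m) ≤ CεL²` for EVERY
  `ε > 0` give `T_R(ψ)/R² - S_ψ(0) ≤ 8π C L²/R` (`0 < R`, `2R ≤ L`): the defect is `R⁻⁴ Σ_{m≠0} |F_R(m)|² S_ψ(m)` (block Plancherel,
  file 1); the UPPER kernel bounds `|F_R(m)|² ≤ R⁴`, `|F_R(m)|²|q_m|² ≤ 2π²R²` dominate the weight by the dyadic staircase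
  `Σ_{k≤R} 4^{-k}·1[|q_m| ≤ 2π2^{k+1}/R]` (`mcc_weight_le_dyadic`); sum the window bounds level by level (`Σ_k 4^{-k}2^{k+1} ≤ 4`).
* `mesoscopicCeiling_of_wib` — crux ⇒ (MC) (`R₀ = 1`, via the landed all-`ε` form `Negative.windowInfraredBound_allEps`);
  `wib_iff_mesoscopicCeiling` — `FunctionFieldCertificate.WindowInfraredBound ↔ (MC)`.
Sources: Kennedy–Lieb–Shastry, PRL 61 (1988) 2582 [KLS1988PRL]; Stein–Shakarchi, *Fourier Analysis*, Ch. 2; Friedli–Velenik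
(2017) §10.4. Upper kernel bounds adapted from `Theorems/WeakCouplingBCSWcbcsSsbToTorusLROFejerClosure.lean` (private there).
-/

noncomputable section

-- summit = problem name (single-conjunct summit, D-0017): `HubbardSuperconductivity` occurs twice in the path
set_option linter.dupNamespace false

namespace Summit.HubbardSuperconductivity.HubbardSuperconductivity.Theorems.WindowInfraredBound

open Literature.MathematicalPhysics.QuantumLattice Literature.Probability.LatticeModels Matrix Finset
open scoped ComplexConjugate ComplexOrder
open Summit.HubbardSuperconductivity.HubbardSuperconductivity.Theses

/-! ### The block kernel from ABOVE (adapted from the Fejér closure file, private there) -/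

section Kernel

variable {L : ℕ} [NeZero L]

/-- `Σ_{v<R} e(k v) = Σ_{i<R} e(k)^i`. [folklore] -/
private theorem mcc_sum_stdAddChar_eq_geom_sum (k : ZMod L) (R : ℕ) :
    ∑ v : Fin R, (ZMod.stdAddChar (k * ((v : ℕ) : ZMod L)) : ℂ) =
      ∑ i ∈ Finset.range R, (ZMod.stdAddChar k : ℂ) ^ i := by
  -- adapted from Theorems/WeakCouplingBCSWcbcsSsbToTorusLROFejerClosure.lean
  rw [Finset.sum_range]
  refine Finset.sum_congr rfl fun v _ => ?_
  rw [← AddChar.map_nsmul_eq_pow, nsmul_eq_mul, mul_comm]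

/-- `|Σ_{v<R} e(k v)| ≤ R`. [folklore] -/
private theorem mcc_norm_sum_stdAddChar_le (k : ZMod L) (R : ℕ) :
    ‖∑ v : Fin R, (ZMod.stdAddChar (k * ((v : ℕ) : ZMod L)) : ℂ)‖ ≤ R := by
  refine (norm_sum_le _ _).trans ?_
  simp

/-- For `|ω| = 1`: `|Σ_{i<R} ω^i| · |ω - 1| = |ω^R - 1| ≤ 2`. [folklore] -/
private theorem mcc_norm_geom_sum_mul_norm_sub_one_le (ω : ℂ) (hω : ‖ω‖ = 1) (R : ℕ) :
    ‖∑ i ∈ Finset.range R, ω ^ i‖ * ‖ω - 1‖ ≤ 2 := by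
  rw [← norm_mul, geom_sum_mul]
  refine (norm_sub_le _ _).trans ?_
  rw [norm_pow, hω, one_pow, norm_one]
  norm_num

/-- Jordan's inequality in the form `4|n| ≤ L · |e^{2πi n/L} - 1|` for `|n| ≤ L/2`. [folklore] -/
private theorem mcc_four_mul_abs_le_mul_norm_exp_sub_one (n : ℤ) (hn : |(n : ℝ)| ≤ L / 2) :
    4 * |(n : ℝ)| ≤ L * ‖Complex.exp (2 * Real.pi * Complex.I * n / L) - 1‖ := by
  -- adapted from Theorems/WeakCouplingBCSWcbcsSsbToTorusLROFejerClosure.lean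
  have hL : (0 : ℝ) < L := Nat.cast_pos.2 (Nat.pos_of_ne_zero (NeZero.ne L))
  have h : (2 * Real.pi * Complex.I * n / L : ℂ) =
      Complex.I * ((2 * Real.pi * n / L : ℝ) : ℂ) := by
    push_cast
    ring
  have hx' : (2 * Real.pi * n / L : ℝ) / 2 = Real.pi * (n / L) := by ring
  rw [h, Complex.norm_exp_I_mul_ofReal_sub_one, Real.norm_eq_abs, abs_mul, abs_two, hx']
  have hnL : |(n : ℝ) / L| ≤ 1 / 2 := by
    rw [abs_div, abs_of_pos hL, div_le_iff₀ hL]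
    linarith
  have hx : |Real.pi * ((n : ℝ) / L)| ≤ Real.pi / 2 := by
    rw [abs_mul, abs_of_pos Real.pi_pos]
    calc Real.pi * |(n : ℝ) / L| ≤ Real.pi * (1 / 2) :=
          mul_le_mul_of_nonneg_left hnL Real.pi_pos.le
      _ = Real.pi / 2 := by ring
  have hj := Real.mul_abs_le_abs_sin hx
  rw [abs_mul, abs_of_pos Real.pi_pos, abs_div, abs_of_pos hL] at hj
  have hj' : 2 / Real.pi * (Real.pi * (|(n : ℝ)| / L)) = 2 * |(n : ℝ)| / L := by
    field_simp
  rw [hj'] at hj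
  have := mul_le_mul_of_nonneg_left hj hL.le
  rw [mul_div_cancel₀ _ hL.ne'] at this
  calc 4 * |(n : ℝ)| = 2 * (2 * |(n : ℝ)|) := by ring
    _ ≤ 2 * ((L : ℝ) * |Real.sin (Real.pi * (n / L))|) := by linarith
    _ = L * (2 * |Real.sin (Real.pi * (n / L))|) := by ring

/-- `|valMinAbs k| ≤ L/2` (real cast). [folklore] -/
private theorem mcc_abs_valMinAbs_le (k : ZMod L) : |((k.valMinAbs : ℤ) : ℝ)| ≤ L / 2 := by
  have h := ZMod.valMinAbs_mem_Ioc k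
  rw [Set.mem_Ioc] at h
  have h1 : ((-(L : ℕ) : ℤ) : ℝ) < ((k.valMinAbs * 2 : ℤ) : ℝ) := by exact_mod_cast h.1
  have h2 : ((k.valMinAbs * 2 : ℤ) : ℝ) ≤ ((L : ℕ) : ℤ) := by exact_mod_cast h.2
  push_cast at h1 h2
  rw [abs_le]
  constructor <;> linarith

/-- **Upper kernel bound in one coordinate**: `|Σ_{v<R} e(k v)|² · q_k² ≤ π²`, `q_k = 2π valMinAbs k / L`.
Stein–Shakarchi, *Fourier Analysis*, Ch. 2. [folklore] -/
private theorem mcc_norm_sum_stdAddChar_sq_mul_le (k : ZMod L) (R : ℕ) :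
    ‖∑ v : Fin R, (ZMod.stdAddChar (k * ((v : ℕ) : ZMod L)) : ℂ)‖ ^ 2 *
        ((2 * Real.pi / L) ^ 2 * ((k.valMinAbs : ℤ) : ℝ) ^ 2) ≤ Real.pi ^ 2 := by
  -- adapted from Theorems/WeakCouplingBCSWcbcsSsbToTorusLROFejerClosure.lean
  have hL : (0 : ℝ) < L := Nat.cast_pos.2 (Nat.pos_of_ne_zero (NeZero.ne L))
  have hω : (ZMod.stdAddChar k : ℂ) =
      Complex.exp (2 * Real.pi * Complex.I * (k.valMinAbs : ℤ) / L) := by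
    have h := ZMod.stdAddChar_coe (N := L) k.valMinAbs
    rwa [ZMod.coe_valMinAbs] at h
  have hn : |((k.valMinAbs : ℤ) : ℝ)| ≤ L / 2 := mcc_abs_valMinAbs_le k
  have hnorm : ‖(ZMod.stdAddChar k : ℂ)‖ = 1 := by simp
  have h1 := mcc_norm_geom_sum_mul_norm_sub_one_le _ hnorm R
  rw [← mcc_sum_stdAddChar_eq_geom_sum] at h1
  have h2 := mcc_four_mul_abs_le_mul_norm_exp_sub_one (L := L) k.valMinAbs hn
  rw [← hω] at h2
  set G := ∑ v : Fin R, (ZMod.stdAddChar (k * ((v : ℕ) : ZMod L)) : ℂ) with hG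
  have h3 : ‖G‖ * (2 * |((k.valMinAbs : ℤ) : ℝ)|) ≤ L := by
    have := calc ‖G‖ * (4 * |((k.valMinAbs : ℤ) : ℝ)|)
          ≤ ‖G‖ * (L * ‖(ZMod.stdAddChar k : ℂ) - 1‖) :=
            mul_le_mul_of_nonneg_left h2 (norm_nonneg _)
      _ = L * (‖G‖ * ‖(ZMod.stdAddChar k : ℂ) - 1‖) := by ring
      _ ≤ L * 2 := mul_le_mul_of_nonneg_left h1 hL.le
    linarith
  have h4 : (‖G‖ * (2 * |((k.valMinAbs : ℤ) : ℝ)|)) ^ 2 ≤ (L : ℝ) ^ 2 :=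
    pow_le_pow_left₀ (by positivity) h3 2
  have h5 : ‖G‖ ^ 2 * ((2 * Real.pi / L) ^ 2 * ((k.valMinAbs : ℤ) : ℝ) ^ 2) =
      (‖G‖ * (2 * |((k.valMinAbs : ℤ) : ℝ)|)) ^ 2 * (Real.pi ^ 2 / (L : ℝ) ^ 2) := by
    rw [mul_pow, mul_pow, sq_abs]
    field_simp
  rw [h5]
  calc _ ≤ (L : ℝ) ^ 2 * (Real.pi ^ 2 / (L : ℝ) ^ 2) :=
        mul_le_mul_of_nonneg_right h4 (by positivity)
    _ = Real.pi ^ 2 := by field_simp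

/-- The block kernel factorises over coordinates. [folklore] -/
private theorem mcc_blockKernel_eq_prod {d : ℕ} (m : TorusSite d L) (R : ℕ) :
    ∑ u : Fin d → Fin R, torusChar m (fun i => ((u i : ℕ) : ZMod L)) =
      ∏ i, ∑ v : Fin R, (ZMod.stdAddChar (m i * ((v : ℕ) : ZMod L)) : ℂ) := by
  rw [Fintype.prod_sum]
  rfl

/-- `|F(m)| ≤ R^d`. [folklore] -/
private theorem mcc_norm_blockKernel_le {d : ℕ} (m : TorusSite d L) (R : ℕ) :
    ‖∑ u : Fin d → Fin R, torusChar m (fun i => ((u i : ℕ) : ZMod L))‖ ≤ (R : ℝ) ^ d := by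
  refine (norm_sum_le _ _).trans ?_
  simp

/-- **Off-window kernel bound** (`d = 2`): `|F(m)|² |q_m|² ≤ 2π² R²`. [folklore] -/
private theorem mcc_norm_blockKernel_sq_mul_momentumNormSq_le (m : TorusSite 2 L) (R : ℕ) :
    ‖∑ u : Fin 2 → Fin R, torusChar m (fun i => ((u i : ℕ) : ZMod L))‖ ^ 2 * momentumNormSq L m ≤
      2 * Real.pi ^ 2 * (R : ℝ) ^ 2 := by
  -- adapted from Theorems/WeakCouplingBCSWcbcsSsbToTorusLROFejerClosure.lean
  rw [mcc_blockKernel_eq_prod, norm_prod, Fin.prod_univ_two, momentumNormSq_apply, Fin.sum_univ_two]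
  have h0 := mcc_norm_sum_stdAddChar_le (m 0) R
  have h1 := mcc_norm_sum_stdAddChar_le (m 1) R
  have k0 := mcc_norm_sum_stdAddChar_sq_mul_le (m 0) R
  have k1 := mcc_norm_sum_stdAddChar_sq_mul_le (m 1) R
  set G0 := ‖∑ v : Fin R, (ZMod.stdAddChar (m 0 * ((v : ℕ) : ZMod L)) : ℂ)‖
  set G1 := ‖∑ v : Fin R, (ZMod.stdAddChar (m 1 * ((v : ℕ) : ZMod L)) : ℂ)‖
  have hG0 : G0 ^ 2 ≤ (R : ℝ) ^ 2 := pow_le_pow_left₀ (norm_nonneg _) h0 2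
  have hG1 : G1 ^ 2 ≤ (R : ℝ) ^ 2 := pow_le_pow_left₀ (norm_nonneg _) h1 2
  calc (G0 * G1) ^ 2 * ((2 * Real.pi / L) ^ 2 *
          ((((m 0).valMinAbs : ℤ) : ℝ) ^ 2 + (((m 1).valMinAbs : ℤ) : ℝ) ^ 2))
        = G1 ^ 2 * (G0 ^ 2 * ((2 * Real.pi / L) ^ 2 * (((m 0).valMinAbs : ℤ) : ℝ) ^ 2)) +
          G0 ^ 2 * (G1 ^ 2 * ((2 * Real.pi / L) ^ 2 * (((m 1).valMinAbs : ℤ) : ℝ) ^ 2)) := by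
          ring
    _ ≤ (R : ℝ) ^ 2 * Real.pi ^ 2 + (R : ℝ) ^ 2 * Real.pi ^ 2 :=
          add_le_add (mul_le_mul hG1 k0 (by positivity) (by positivity))
            (mul_le_mul hG0 k1 (by positivity) (by positivity))
    _ = 2 * Real.pi ^ 2 * (R : ℝ) ^ 2 := by ring

/-- Every Brillouin-zone momentum has `|q_m|² ≤ 2π²` (`|valMinAbs mᵢ| ≤ L/2`). [folklore] -/
private theorem mcc_momentumNormSq_le (m : TorusSite 2 L) : momentumNormSq L m ≤ 2 * Real.pi ^ 2 := by
  have hL : (0 : ℝ) < L := Nat.cast_pos.2 (Nat.pos_of_ne_zero (NeZero.ne L))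
  have hn : ∀ i : Fin 2, (((m i).valMinAbs : ℤ) : ℝ) ^ 2 ≤ ((L : ℝ) / 2) ^ 2 := fun i =>
    (sq_abs _).symm.trans_le (pow_le_pow_left₀ (abs_nonneg _) (mcc_abs_valMinAbs_le (m i)) 2)
  rw [momentumNormSq_apply, Fin.sum_univ_two]
  calc (2 * Real.pi / (L : ℝ)) ^ 2 * ((((m 0).valMinAbs : ℤ) : ℝ) ^ 2 + (((m 1).valMinAbs : ℤ) : ℝ) ^ 2)
      ≤ (2 * Real.pi / (L : ℝ)) ^ 2 * (((L : ℝ) / 2) ^ 2 + ((L : ℝ) / 2) ^ 2) :=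
        mul_le_mul_of_nonneg_left (add_le_add (hn 0) (hn 1)) (sq_nonneg _)
    _ = 2 * Real.pi ^ 2 := by
        field_simp
        ring

/-- **Dyadic staircase domination of the block weight** (`0 < R`, `m ≠ 0`): `|F_R(m)|²/R⁴ ≤ Σ_{k≤R} 4^{-k}·1[|q_m|² ≤ (2π2^{k+1}/R)²]`
(level `0` if `|q_m| ≤ 4π/R`, else the level `n` with `|q_m|²/(2π/R)² ∈ [4^n, 4^{n+1})`, `n ≤ R` as `|q_m|² ≤ 2π²`). [folklore] -/
private theorem mcc_weight_le_dyadic (R : ℕ) (hR : 0 < R) {m : TorusSite 2 L} (hm : m ≠ 0) :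
    ‖∑ u : Fin 2 → Fin R, torusChar m (fun i => ((u i : ℕ) : ZMod L))‖ ^ 2 / (R : ℝ) ^ 4 ≤
      ∑ k ∈ Finset.range (R + 1), (1 / 4 : ℝ) ^ k *
        (if momentumNormSq L m ≤ (2 * Real.pi * 2 ^ (k + 1) / (R : ℝ)) ^ 2 then 1 else 0) := by
  have hRr : (0 : ℝ) < R := Nat.cast_pos.2 hR
  set F : ℂ := ∑ u : Fin 2 → Fin R, torusChar m (fun i => ((u i : ℕ) : ZMod L)) with hF
  set q : ℝ := momentumNormSq L m with hq
  have hqpos : 0 < q := (momentumNormSq_nonneg m).lt_of_ne' (fun h0 => hm ((momentumNormSq_eq_zero_iff m).1 h0))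
  have hq2 : q ≤ 2 * Real.pi ^ 2 := mcc_momentumNormSq_le m
  -- the two kernel bounds in normalised form
  have hw1 : ‖F‖ ^ 2 / (R : ℝ) ^ 4 ≤ 1 := by
    rw [div_le_one (by positivity), show (R : ℝ) ^ 4 = ((R : ℝ) ^ 2) ^ 2 by ring]
    exact pow_le_pow_left₀ (norm_nonneg _) (mcc_norm_blockKernel_le m R) 2
  have hw2 : ‖F‖ ^ 2 / (R : ℝ) ^ 4 * q ≤ (2 * Real.pi / (R : ℝ)) ^ 2 := by
    have h := mcc_norm_blockKernel_sq_mul_momentumNormSq_le m R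
    rw [← hF, ← hq] at h
    rw [div_mul_eq_mul_div, div_le_iff₀ (by positivity)]
    calc ‖F‖ ^ 2 * q ≤ 2 * Real.pi ^ 2 * (R : ℝ) ^ 2 := h
      _ ≤ 4 * Real.pi ^ 2 * (R : ℝ) ^ 2 := by nlinarith [Real.pi_pos]
      _ = (2 * Real.pi / (R : ℝ)) ^ 2 * (R : ℝ) ^ 4 := by field_simp; ring
  -- all staircase terms are nonnegative
  have hnn : ∀ k ∈ Finset.range (R + 1), 0 ≤ (1 / 4 : ℝ) ^ k *
      (if momentumNormSq L m ≤ (2 * Real.pi * 2 ^ (k + 1) / (R : ℝ)) ^ 2 then 1 else 0) := by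
    intro k _
    split_ifs <;> positivity
  set a : ℝ := 2 * Real.pi / (R : ℝ) with ha
  have hapos : 0 < a := by positivity
  by_cases h0 : q ≤ (2 * Real.pi * 2 ^ (0 + 1) / (R : ℝ)) ^ 2
  · -- level `k = 0`
    have hmem : 0 ∈ Finset.range (R + 1) := by simp
    refine le_trans ?_ (Finset.single_le_sum hnn hmem)
    rw [if_pos h0, pow_zero, one_mul]
    exact hw1
  · -- level `k = n` with `4^n ≤ q/a² < 4^{n+1}`
    set t : ℝ := q / a ^ 2 with ht
    have h0' : (2 * a) ^ 2 < q := by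
      have : (2 * Real.pi * 2 ^ (0 + 1) / (R : ℝ)) = 2 * a := by rw [ha]; ring
      rw [this] at h0
      exact lt_of_not_ge h0
    have ht4 : 4 < t := by
      rw [ht, lt_div_iff₀ (by positivity)]
      nlinarith [h0']
    obtain ⟨n, hn1, hn2⟩ := exists_nat_pow_near (x := t) (y := (4 : ℝ)) (by linarith) (by norm_num)
    -- `n ≤ R`: `4^n ≤ t ≤ 2π²/a² = R²/2`
    have hnR : n ∈ Finset.range (R + 1) := by
      rw [Finset.mem_range, Nat.lt_succ_iff]
      have htR : t ≤ (R : ℝ) ^ 2 := by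
        rw [ht, div_le_iff₀ (by positivity), ha]
        calc q ≤ 2 * Real.pi ^ 2 := hq2
          _ ≤ (R : ℝ) ^ 2 * (2 * Real.pi / (R : ℝ)) ^ 2 := by
              rw [div_pow, mul_div_assoc', le_div_iff₀ (by positivity)]
              nlinarith [Real.pi_pos, sq_nonneg (R : ℝ)]
      have h4n : (4 : ℝ) ^ n = ((2 : ℝ) ^ n) ^ 2 := by
        rw [← pow_mul, mul_comm, pow_mul]; norm_num
      have h2n : (2 : ℝ) ^ n ≤ R := by
        have : ((2 : ℝ) ^ n) ^ 2 ≤ (R : ℝ) ^ 2 := by rw [← h4n]; exact hn1.trans htR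
        exact (pow_le_pow_iff_left₀ (by positivity) hRr.le two_ne_zero).1 this
      have h2n' : 2 ^ n ≤ R := by exact_mod_cast h2n
      exact (Nat.lt_two_pow_self).le.trans h2n'
    refine le_trans ?_ (Finset.single_le_sum hnn hnR)
    have hlevel : q ≤ (2 * Real.pi * 2 ^ (n + 1) / (R : ℝ)) ^ 2 := by
      have : (2 * Real.pi * 2 ^ (n + 1) / (R : ℝ)) ^ 2 = a ^ 2 * 4 ^ (n + 1) := by
        have h4 : (4 : ℝ) ^ (n + 1) = ((2 : ℝ) ^ (n + 1)) ^ 2 := by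
          rw [← pow_mul, mul_comm, pow_mul]; norm_num
        rw [h4, ha]
        ring
      rw [this]
      have := hn2.le
      rw [ht, div_le_iff₀ (by positivity)] at this
      linarith
    rw [if_pos hlevel, mul_one]
    -- `w ≤ a²/q = 1/t ≤ 4^{-n}`
    have hwq : ‖F‖ ^ 2 / (R : ℝ) ^ 4 ≤ a ^ 2 / q := by
      rw [le_div_iff₀ hqpos]
      exact hw2
    refine hwq.trans ?_
    rw [div_le_iff₀ hqpos, _root_.one_div_pow]
    have : a ^ 2 * 4 ^ n ≤ q := by
      have := hn1
      rw [ht, le_div_iff₀ (by positivity)] at this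
      linarith
    calc a ^ 2 = a ^ 2 * 4 ^ n * (1 / 4 ^ n) := by field_simp
      _ ≤ q * (1 / 4 ^ n) := mul_le_mul_of_nonneg_right this (by positivity)
      _ = 1 / 4 ^ n * q := by ring

end Kernel

/-! ### The defect from the window bounds (Abel / dyadic summation) -/

section Converse

/-- **Block-coherence defect from window bounds** (one side, one vector, any form factor `g`): if
`Σ_{m ≠ 0, |q_m| ≤ ε} S_ψ(m) ≤ C ε L²` for EVERY `ε > 0`, then `T_R(ψ)/R² - S_ψ(0) ≤ 8π C L²/R` for `0 < R`, `2R ≤ L`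
(defect `= Σ_{m≠0} |F_R(m)|²/R⁴ · S_ψ(m)` by block Plancherel; staircase domination; window bound per level; `Σ_k 4^{-k}2^{k+1} ≤ 4`).
Kennedy–Lieb–Shastry, PRL 61 (1988) 2582; Stein–Shakarchi, *Fourier Analysis*, Ch. 2. [folklore] -/
theorem blockDefect_le_of_windowBounds (g : Site 2 → ℝ) (L : ℕ) [NeZero L] (R : ℕ) (hR : 0 < R)
    (hRL : 2 * R ≤ L) {C : ℝ} (hC : 0 ≤ C) (ψ : Fock (Orb (FermionTorus 2 L)))
    (hW : ∀ ε : ℝ, 0 < ε →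
      (∑ m : TorusSite 2 L, if m ≠ 0 ∧ momentumNormSq L m ≤ ε ^ 2 then pairStructureFactor g L ψ m else 0) ≤
        C * ε * (L : ℝ) ^ 2) :
    (∑ x : TorusSite 2 L, ∑ y : TorusSite 2 L,
        (∏ i : Fin 2, max 0 (1 - |(((y i - x i).valMinAbs : ℤ) : ℝ)| / (R : ℝ))) *
          (star (localPair g L x *ᵥ ψ) ⬝ᵥ (localPair g L y *ᵥ ψ)).re) / (R : ℝ) ^ 2 -
      pairStructureFactor g L ψ 0 ≤ 8 * Real.pi * C * (L : ℝ) ^ 2 / (R : ℝ) := by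
  have hRr : (0 : ℝ) < R := Nat.cast_pos.2 hR
  have hR2 : (0 : ℝ) < (R : ℝ) ^ 2 := by positivity
  have hR4 : (0 : ℝ) < (R : ℝ) ^ 4 := by positivity
  have hP := sq_mul_fejerBoxCorr_eq_sum_blockKernel_sq_mul g L R hR hRL ψ
  set T : ℝ := ∑ x : TorusSite 2 L, ∑ y : TorusSite 2 L,
        (∏ i : Fin 2, max 0 (1 - |(((y i - x i).valMinAbs : ℤ) : ℝ)| / (R : ℝ))) *
          (star (localPair g L x *ᵥ ψ) ⬝ᵥ (localPair g L y *ᵥ ψ)).re with hT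
  set S : TorusSite 2 L → ℝ := pairStructureFactor g L ψ with hS
  obtain ⟨F, hF⟩ : ∃ F : TorusSite 2 L → ℂ,
      ∀ m, F m = ∑ u : Fin 2 → Fin R, torusChar m (fun i => ((u i : ℕ) : ZMod L)) :=
    ⟨fun m => _, fun m => rfl⟩
  simp only [← hF] at hP
  have hSnn : ∀ m, 0 ≤ S m := fun m => pairStructureFactor_nonneg g L ψ m
  have hF0 : ‖F 0‖ ^ 2 = (R : ℝ) ^ 4 := by
    have h0 : F 0 = (R : ℂ) ^ 2 := by rw [hF]; simp
    rw [h0, norm_pow, Complex.norm_natCast]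
    ring
  -- levels and their window sums
  set εk : ℕ → ℝ := fun k => 2 * Real.pi * 2 ^ (k + 1) / (R : ℝ) with hεk
  have hεkpos : ∀ k, 0 < εk k := fun k => by positivity
  -- Step 1: the defect as a weighted sum, `T/R² - S 0 = Σ_m (w m · S m) - S 0`, `w 0 = 1`
  have hdef : T / (R : ℝ) ^ 2 - S 0 = ∑ m, (‖F m‖ ^ 2 / (R : ℝ) ^ 4 * S m - if m = 0 then S m else 0) := by
    rw [Finset.sum_sub_distrib, Fintype.sum_ite_eq']
    congr 1
    calc T / (R : ℝ) ^ 2 = ((R : ℝ) ^ 2 * T) / (R : ℝ) ^ 4 := by field_simp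
      _ = (∑ m, ‖F m‖ ^ 2 * S m) / (R : ℝ) ^ 4 := by rw [hP]
      _ = _ := by
          rw [Finset.sum_div]
          exact Finset.sum_congr rfl fun m _ => by ring
  -- Step 2: pointwise staircase domination
  have hpt : ∀ m ∈ (Finset.univ : Finset (TorusSite 2 L)),
      (‖F m‖ ^ 2 / (R : ℝ) ^ 4 * S m - if m = 0 then S m else 0) ≤
        ∑ k ∈ Finset.range (R + 1), (1 / 4 : ℝ) ^ k *
          (if m ≠ 0 ∧ momentumNormSq L m ≤ εk k ^ 2 then S m else 0) := by
    intro m _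
    by_cases hm : m = 0
    · subst hm
      rw [if_pos rfl, hF0, div_self hR4.ne', one_mul, sub_self]
      refine Finset.sum_nonneg fun k _ => ?_
      simp
    · rw [if_neg hm, sub_zero]
      have hw := mcc_weight_le_dyadic (L := L) R hR hm
      rw [← hF] at hw
      calc ‖F m‖ ^ 2 / (R : ℝ) ^ 4 * S m
          ≤ (∑ k ∈ Finset.range (R + 1), (1 / 4 : ℝ) ^ k *
              (if momentumNormSq L m ≤ (2 * Real.pi * 2 ^ (k + 1) / (R : ℝ)) ^ 2 then 1 else 0)) * S m :=
            mul_le_mul_of_nonneg_right hw (hSnn m)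
        _ = _ := by
            rw [Finset.sum_mul]
            refine Finset.sum_congr rfl fun k _ => ?_
            simp only [hεk, ne_eq, hm, not_false_eq_true, true_and]
            split_ifs <;> ring
  -- Step 3: swap the sums and apply the window bounds level by level
  have hsum : T / (R : ℝ) ^ 2 - S 0 ≤
      ∑ k ∈ Finset.range (R + 1), (1 / 4 : ℝ) ^ k * (C * εk k * (L : ℝ) ^ 2) := by
    rw [hdef]
    refine (Finset.sum_le_sum hpt).trans ?_
    rw [Finset.sum_comm]
    refine Finset.sum_le_sum fun k _ => ?_
    rw [← Finset.mul_sum]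
    exact mul_le_mul_of_nonneg_left (hW (εk k) (hεkpos k)) (by positivity)
  -- Step 4: the geometric sum `Σ_k 4^{-k} · (2π 2^{k+1}/R) = (4π/R) Σ_k 2^{-k} ≤ 8π/R`
  have hgeom : ∑ k ∈ Finset.range (R + 1), (1 / 4 : ℝ) ^ k * (C * εk k * (L : ℝ) ^ 2) =
      4 * Real.pi * C * (L : ℝ) ^ 2 / (R : ℝ) * ∑ k ∈ Finset.range (R + 1), (1 / 2 : ℝ) ^ k := by
    rw [Finset.mul_sum]
    refine Finset.sum_congr rfl fun k _ => ?_
    rw [hεk]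
    have h42 : (1 / 4 : ℝ) ^ k * 2 ^ (k + 1) = 2 * (1 / 2) ^ k := by
      rw [pow_succ, _root_.one_div_pow, _root_.one_div_pow,
        show (4 : ℝ) ^ k = 2 ^ k * 2 ^ k by rw [← mul_pow]; norm_num]
      field_simp
    calc (1 / 4 : ℝ) ^ k * (C * (2 * Real.pi * 2 ^ (k + 1) / (R : ℝ)) * (L : ℝ) ^ 2)
        = ((1 / 4 : ℝ) ^ k * 2 ^ (k + 1)) * (2 * Real.pi * C * (L : ℝ) ^ 2 / (R : ℝ)) := by ring
      _ = 2 * (1 / 2) ^ k * (2 * Real.pi * C * (L : ℝ) ^ 2 / (R : ℝ)) := by rw [h42]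
      _ = _ := by ring
  have h2 := shellCover_geom_sum_le_two (R + 1)
  calc T / (R : ℝ) ^ 2 - S 0 ≤ _ := hsum
    _ = _ := hgeom
    _ ≤ 4 * Real.pi * C * (L : ℝ) ^ 2 / (R : ℝ) * 2 := mul_le_mul_of_nonneg_left h2 (by positivity)
    _ = 8 * Real.pi * C * (L : ℝ) ^ 2 / (R : ℝ) := by ring

/-- **Crux ⇒ (MC)**: `WindowInfraredBound` implies the mesoscopic ceiling (`R₀ = 1`, `C_MC = 8π·C_allε`), by the all-`ε` window
bound `Negative.windowInfraredBound_allEps` and `blockDefect_le_of_windowBounds`; with `wib_of_mesoscopicCeiling` (file 2) this makes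
(MC) an EQUIVALENT restatement of the crux (`wib_iff_mesoscopicCeiling`). [folklore] -/
theorem mesoscopicCeiling_of_wib : FunctionFieldCertificate.WindowInfraredBound → (∀ U : ℝ, 0 < U → ∀ δ ∈ Set.Ioo (0:ℝ) (1 / 2), ∃ C : ℝ, 0 ≤ C ∧ ∃ R₀ L₀ : ℕ, ∀ (L : ℕ) [NeZero L], L₀ ≤ L → Even L → ∀ ψ : Fock (Orb (FermionTorus 2 L)), star ψ ⬝ᵥ ψ = 1 → IsGroundStateInSector (hubbardTorus 2 L 1 U) (2 * ⌊(1 - δ) * (L : ℝ) ^ 2 / 2⌋₊) 0 ψ → ∀ R : ℕ, R₀ ≤ R → 2 * R ≤ L → (∑ x : TorusSite 2 L, ∑ y : TorusSite 2 L, (∏ i : Fin 2, max 0 (1 - |(((y i - x i).valMinAbs : ℤ) : ℝ)| / (R : ℝ))) * (star (localPair dWaveFormFactor L x *ᵥ ψ) ⬝ᵥ (localPair dWaveFormFactor L y *ᵥ ψ)).re) / (R : ℝ) ^ 2 - pairStructureFactor dWaveFormFactor L ψ 0 ≤ C * (L : ℝ) ^ 2 / (R : ℝ)) := by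
  intro hW U hU δ hδ
  obtain ⟨C, hC, L₀, hall⟩ :=
    Negative.windowInfraredBound_allEps (wib_functionField_iff_kac.1 hW) U hU δ hδ
  refine ⟨8 * Real.pi * C, by positivity, 1, L₀, ?_⟩
  intro L _ hL hev ψ hψ hgs R hR1 h2R
  exact blockDefect_le_of_windowBounds dWaveFormFactor L R hR1 h2R hC ψ
    (fun ε hε => hall ε hε L hL hev ψ hψ hgs)

/-- **`WindowInfraredBound ↔ (MC)`** — the crux is equivalent to the mesoscopic ceiling of idea `mesoscopic-ceiling-block-coherence`
(block-language, certificate-per-`R` restatement in the Fejér-box vocabulary of `MesoscopicPairOrder`). [folklore] -/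
theorem wib_iff_mesoscopicCeiling : FunctionFieldCertificate.WindowInfraredBound ↔ (∀ U : ℝ, 0 < U → ∀ δ ∈ Set.Ioo (0:ℝ) (1 / 2), ∃ C : ℝ, 0 ≤ C ∧ ∃ R₀ L₀ : ℕ, ∀ (L : ℕ) [NeZero L], L₀ ≤ L → Even L → ∀ ψ : Fock (Orb (FermionTorus 2 L)), star ψ ⬝ᵥ ψ = 1 → IsGroundStateInSector (hubbardTorus 2 L 1 U) (2 * ⌊(1 - δ) * (L : ℝ) ^ 2 / 2⌋₊) 0 ψ → ∀ R : ℕ, R₀ ≤ R → 2 * R ≤ L → (∑ x : TorusSite 2 L, ∑ y : TorusSite 2 L, (∏ i : Fin 2, max 0 (1 - |(((y i - x i).valMinAbs : ℤ) : ℝ)| / (R : ℝ))) * (star (localPair dWaveFormFactor L x *ᵥ ψ) ⬝ᵥ (localPair dWaveFormFactor L y *ᵥ ψ)).re) / (R : ℝ) ^ 2 - pairStructureFactor dWaveFormFactor L ψ 0 ≤ C * (L : ℝ) ^ 2 / (R : ℝ)) :=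
  ⟨mesoscopicCeiling_of_wib, wib_of_mesoscopicCeiling⟩

end Converse
end Summit.HubbardSuperconductivity.HubbardSuperconductivity.Theorems.WindowInfraredBound

end
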